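import Literature.AnabelianGeometry.EtaleTheta.Discharge.Sec3Cor38CriterionRemark363AtRankOnePoint
import Literature.AnabelianGeometry.EtaleTheta.Discharge.Sec3Cor38iiOfInputs

/-!
# [EtTh] Corollary 3.8: «`Ψ` preserves the base-field-theoretic morphisms», the hull equivalence, and «`Ψ` preserves factorisations» AT THE RANK-ONE-POINT MODELS OF RECORD — as SEPARATELY NAMED heads

S. Mochizuki, *The étale theta function and its Frobenioid-theoretic manifestations*, Publ. RIMS **45** (2009), Cor. 3.8 (i)/(ii) p. 80–81
("`Ψ` preserves the base-field-theoretic morphisms … and induces a compatible equivalence `C₁^{bs-fld} ⥲ C₂^{bs-fld}`"), proof p. 81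
l.15–19 (factorisations `F ∘ φ ∘ λ` are preserved) [cite: MochizukiEtTh2009, Cor 3.8 p.80–81].

abc-iut cell, D-0079 ORIGINAL-L / L-F [EtTh] (FACT rows F-0580 `PreservesBaseFieldTheoretic`, F-2823 `InducesHullEquivalence`, F-2818
`PreservesFactorisation`; cone nodes `EtTh:Cor3.8(i)`/`(ii)`), seat abc-iut-w6-d053 (gen 5), third companion of the census `LF-ETTH-S3.tsv`.
PROOF-ONLY (0 definitions, no instance, no new `Prop`).  The first two heads are the two CONJUNCTS of abc-iut-L2-d2's
`TemperedFrobenioid.cor38_ii_conclusion_ofRankOnePoint` (`Discharge/Sec3Cor38OfRankOnePoint.lean`, p449948) — named apart here because the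
L-F book lists them as separate FACT rows; the third is abc-iut-L2-t3's reduction `Cor38Hyp.preservesFactorisation_of_thm34` fed, exactly as in
abc-iut-L2-d2's `preservesLinear_of_isFrobenioid_weak`, with [FrdI] Thm. 3.4 (ii) PROVED (`FrdI.Thm34ii_holds`, F-0711), `IsFrobenioid`
(`isFrobenioid_ofRankOnePoint`), pre-step preservation (`preservesPreSteps_of_isFrobenioid_weak`) and «standard, isotropic, not group-like» over
the weak vocabulary (`standardIsotropicNotGroupLike_treeMonoidVocabWeak`) — all THEOREMS at abc-iut-w6-d048's `ofRankOnePoint hZ P hpf R S`.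
Everything BY NAME; nothing landed is edited or restated.
* `cor38Hyp_preservesBaseFieldTheoretic_ofRankOnePoint` — **F-0580, for every `Cor38Hyp h`, NO further hypothesis**;
* `cor38Hyp_inducesHullEquivalence_ofRankOnePoint` — **F-2823, idem** (the `∃ Ψ^{bs}` clause IS `InducesHullEquivalence` by definition);
* `cor38Hyp_preservesFactorisation_ofRankOnePoint` — **F-2818, idem**;
* the `TateTowerFrd` specialisations at the model of record.
HONEST FRAMING: instantiation certificates at semi-synthetic models of record (one point of `D₀` each); the bare schemas stay refuted; refereed
pre-IUT material; nothing here bears on [IUTchIII] Cor. 3.12; no side taken; typed ≠ proved.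
-/

noncomputable section

namespace Literature.AnabelianGeometry.EtaleTheta

open CategoryTheory Opposite Function Literature.AlgebraicGeometry.Frobenioids
  Literature.AnabelianGeometry.SemiGraphs LogDivisorModel LogDivisorModel.GaloisAction

namespace TemperedFrobenioid

section RankOnePair

variable {Z : LogDivisorModel.{0}} {G : Type} [Group G] {A : Z.GaloisAction G} (hZ : Z.CuspLaws) (P : RankOnePoint A)
  (hpf : ∀ Y : ((isConnectedGSet (G := G)).FullSubcategory)ᵒᵖ,
    IsPerfFactorialCof ((DivisorMonoids.ofGaloisActionConnected A hZ).Φ₀.obj Y))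
  (R S : ((Discrete PUnit.{1})ᵒᵖ ⥤ CommMonCat.{0}) → Prop)
  {Z' : LogDivisorModel.{0}} {G' : Type} [Group G'] {A' : Z'.GaloisAction G'} (hZ' : Z'.CuspLaws)
  (P' : RankOnePoint A')
  (hpf' : ∀ Y : ((isConnectedGSet (G := G')).FullSubcategory)ᵒᵖ,
    IsPerfFactorialCof ((DivisorMonoids.ofGaloisActionConnected A' hZ').Φ₀.obj Y))
  (R' S' : ((Discrete PUnit.{1})ᵒᵖ ⥤ CommMonCat.{0}) → Prop)
  (h : Cor38Hyp (ofRankOnePoint hZ P hpf R S) (ofRankOnePoint hZ' P' hpf' R' S'))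

/-- **F-0580 «`Ψ` preserves the base-field-theoretic morphisms» at the rank-one-point models, for every `h`, NO further hypothesis**
(conjunct 1 of abc-iut-L2-d2's `cor38_ii_conclusion_ofRankOnePoint`). [cite: MochizukiEtTh2009, Cor 3.8 p.80] -/
theorem cor38Hyp_preservesBaseFieldTheoretic_ofRankOnePoint : PreservesBaseFieldTheoretic h :=
  (cor38_ii_conclusion_ofRankOnePoint hZ P hpf R S hZ' P' hpf' R' S' h).1

/-- **F-2823 `InducesHullEquivalence` at the rank-one-point models, for every `h`, NO further hypothesis** ("induces a compatible equivalence
`C₁^{bs-fld} ⥲ C₂^{bs-fld}`"; conjunct 2 of `cor38_ii_conclusion_ofRankOnePoint`). [cite: MochizukiEtTh2009, Cor 3.8 p.81] -/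
theorem cor38Hyp_inducesHullEquivalence_ofRankOnePoint : h.InducesHullEquivalence :=
  (cor38_ii_conclusion_ofRankOnePoint hZ P hpf R S hZ' P' hpf' R' S' h).2

/-- **F-2818 «`Ψ` preserves factorisations» at the rank-one-point models, for every `h`, NO further hypothesis** (Cor. 3.8 proof p.81 l.15–19):
abc-iut-L2-t3's `preservesFactorisation_of_thm34` with every input a theorem there ([FrdI] Thm. 3.4 (ii) `FrdI.Thm34ii_holds`, (iii) via
`thm34iii_of_fact`, pre-steps via `preservesPreSteps_of_isFrobenioid_weak`, `HypB` from «standard, isotropic, not group-like» over the weak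
vocabulary). [cite: MochizukiEtTh2009, Cor 3.8 p.81] -/
theorem cor38Hyp_preservesFactorisation_ofRankOnePoint : h.PreservesFactorisation :=
  h.preservesFactorisation_of_thm34
    (h.preservesPreSteps_of_isFrobenioid_weak (isFrobenioid_ofRankOnePoint hZ P hpf R S)
      (isFrobenioid_ofRankOnePoint hZ' P' hpf' R' S'))
    (h.thm34iii_of_fact FrdI.Thm34ii_holds (isFrobenioid_ofRankOnePoint hZ P hpf R S)
      (isFrobenioid_ofRankOnePoint hZ' P' hpf' R' S'))
    (h.thm34iii_symm_of_fact FrdI.Thm34ii_holds (isFrobenioid_ofRankOnePoint hZ P hpf R S)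
      (isFrobenioid_ofRankOnePoint hZ' P' hpf' R' S'))
    h.standardIsotropicNotGroupLike_treeMonoidVocabWeak
    (h.hypB_of_standardIsotropicNotGroupLike h.standardIsotropicNotGroupLike_treeMonoidVocabWeak)
    (h.hypB_symm_of_standardIsotropicNotGroupLike h.standardIsotropicNotGroupLike_treeMonoidVocabWeak)

end RankOnePair

end TemperedFrobenioid

/-! ## At the model of record: the Tate tower -/

namespace TateTowerFrd

variable (R S R' S' : ((Discrete PUnit.{1})ᵒᵖ ⥤ CommMonCat.{0}) → Prop)
  (h : Cor38Hyp (temperedFrobenioid R S) (temperedFrobenioid R' S'))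

/-- F-0580 at the model of record, for every `h`. [cite: MochizukiEtTh2009, Cor 3.8 p.80] -/
theorem cor38Hyp_preservesBaseFieldTheoretic_temperedFrobenioid : PreservesBaseFieldTheoretic h :=
  TemperedFrobenioid.cor38Hyp_preservesBaseFieldTheoretic_ofRankOnePoint _ _ _ R S _ _ _ R' S' h

/-- F-2823 at the model of record, for every `h`. [cite: MochizukiEtTh2009, Cor 3.8 p.81] -/
theorem cor38Hyp_inducesHullEquivalence_temperedFrobenioid : h.InducesHullEquivalence :=
  TemperedFrobenioid.cor38Hyp_inducesHullEquivalence_ofRankOnePoint _ _ _ R S _ _ _ R' S' h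

/-- F-2818 at the model of record, for every `h`. [cite: MochizukiEtTh2009, Cor 3.8 p.81] -/
theorem cor38Hyp_preservesFactorisation_temperedFrobenioid : h.PreservesFactorisation :=
  TemperedFrobenioid.cor38Hyp_preservesFactorisation_ofRankOnePoint _ _ _ R S _ _ _ R' S' h

end TateTowerFrd

end Literature.AnabelianGeometry.EtaleTheta

end
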